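import Literature.NumberTheory.LFunctions.Zhang2022.KnifeEdgeEllVernierEndgame
import Literature.NumberTheory.LFunctions.Zhang2022.Section2Lemma23Holds
import Literature.NumberTheory.LFunctions.Zhang2022.Section4Prop22Eventually

/-!
# §D edge ell — card `ell-vernier-far-pair`: crux K4 (POSITIVITY) is Lemma 2.3 TRANSPORTED — a kernel theorem
# from Proposition 2.2 and a clear far bracket (K2♭); the distance of the far pair plays no role

Y. Zhang, *Discrete mean estimates and the Landau–Siegel zero*, arXiv:2211.02515v1 [Zhang2022LandauSiegel] — an
unrefereed manuscript under adjudication. **WHAT THIS IS NOT: not a claim about Theorems 1–2 of arXiv:2211.02515,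
about Landau–Siegel zeros, about Parity, or about a repaired `Margin232`; the one bare `Prop` below
(`VernierBracketClearAll`, K2♭) is a DEFINITION asserted by no one. The programme SEARCHES and TYPES; no claim about
Landau–Siegel zeros, Theorems 1–2 of arXiv:2211.02515 or a repaired Margin232 until a kernel theorem says so.**
(LANDAU–SIEGEL programme F-S3, cell `landau-siegel`, §D edge ell; typer ls-knife-typer-2 g3; companion of
`KnifeEdgeEllVernier.lean` (K4 `VernierPositivity`, K2 `VernierCoherence…`) and `KnifeEdgeEllVernierEndgame.lean`
(glue `theorem1_of_vernier_coherent_closed`).)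

## The point (second reader ls-knife-crit-3 g4, 2026-08-27T00:00:51Z (r1): «Lemma 2.3 gap-index-free ✓ — the proof
p.6/pp.11–12 uses only M(ρ+iv) ≠ 0 on the two v-ranges + MVT»; tribunal desk T1 00:49:01Z (E4): «the closed glue does
not consume K2»)
The manuscript's proof of Lemma 2.3 (kernel: `Skeleton.M_signs_of_prop22_at`, `Section2Lemma23Holds`) shows
`𝔠*(ρ,ψ) = [M(ρ+β₁)/(iM′(ρ))]·[M(ρ+β₂)M(ρ+β₃)] ≥ 0` from: (near factor) the sub-gap range `(γ, γ+|β₁|]` is free of zeros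
of `L(s,ψ)L(s,ψχ)` and `ρ` is a simple zero on the line; (far factor) `u ↦ M(½+iu,ψ)` is real, continuous and
non-vanishing on `[γ+|β₂|, γ+|β₃|]`. The far factor's argument is INDIFFERENT to where the pair sits, provided the
closed bracket between the two heights is free of product zeros and stays inside `Ω`. Hence for the card's far pair
`(iα̃(J+m), iα̃(J+1−m))`:

* `cstarPair c' D x ρ v v'` — `𝔠*` with the pair `(β₂,β₃)` replaced by free heights `(iv, iv′)`;
  `cstarVernier_eq_cstarPair` (`rfl`): the card's `cstarVernier θ c'` is the instance at the vernier heights.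
* `BracketClearAt χ x ρ v v'` — no product zero in `Ω` with ordinate in `[Im ρ + v, Im ρ + v′]`.
* PROVED `farPair_pos_of_clear` (far factor `M(ρ+iv)M(ρ+iv′)` is a positive real from Prop. 2.2 (i) at `ψ`, `D ≥ 3`,
  `0 < v ≤ v′ < 2`, bracket clear), `cstarPair_pos_at` (with the printed near factor: `𝔠*_{v,v′}(ρ,ψ)` is a POSITIVE
  real under Prop. 2.2 (i)–(iii) at `ψ`), `vernierHeights_eventually` (for `θ ≥ 0`, `D ≥ D₀(θ)`: `0 < α̃(J+m) ≤
  α̃(J+1−m) < 2`, via `α̃J ≤ πθ/(½𝓛 − log 2π) ≤ 1`, `α̃ ≤ π/𝓛⁹`, `m = 𝓛^{−1/4} ≤ ½`; helpers `ell_pow_nine_le_LDelta`,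
  `alphaFence_pos`, `alphaFence_le`).
* K2♭ `VernierBracketClearAll θ` (bare `Prop`, OPEN): under (A), eventually, the far bracket is clear at EVERY coherent
  pair `(ψ,ρ)` — the part of the card's coherence crux K2 that positivity consumes (the second reader's
  `VernierBracketClear θ m` is the same conclusion off an `o(1)` exceptional set of pairs, margin fixed).
* **PROVED `vernierPositivity_of_bracketClearAll : 0 ≤ θ → 0 ≤ c′ → Prop22 c′ → VernierBracketClearAll θ →
  VernierPositivity θ c′`** and the CLOSED form `vernierPositivity_of_bracketClearAll_closed : 0 ≤ θ →
  VernierBracketClearAll θ → ∃ c₀ ≥ 0, ∀ c′ ≥ c₀, VernierPositivity θ c′` (Prop. 2.2 for all large `c′` is the tree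
  theorem `Skeleton.prop22_eventually`). CONSEQUENCE FOR THE ROUTE: K4 is not a crux — it is K2♭ plus kernel theorems;
  the glue `theorem1_of_vernier_coherent_closed` (Endgame file) composed with this one reads
  `VernierDict θ c′ coherentFam F m → m < 0 → VernierBracketClearAll θ → Theorem1` for `θ ≥ 0`, `c′ ≥ c₀`
  (`theorem1_of_vernier_bracketClear`, `theorem1_of_vernier_bracketClear_closed`).
References: Zhang, arXiv:2211.02515v1, §2 Lemma 2.3 and its proof pp. 11–12, Prop. 2.2, (2.13)–(2.14), (2.10)
[cite: Zhang2022LandauSiegel, §2 Lemma 2.3 (proof) pp. 11–12; Prop. 2.2]. In-tree inputs: `Skeleton.M_signs_of_prop22_at`,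
`forAllLarge_of_prop22`, `mul_pos_of_continuousOn_of_ne_zero`, `Mfun_half_eq_ofReal`, `continuousOn_Mfun_half_re`,
`Mfun_ne_zero`, `half_add_mem_Omega` (Section2Lemma23Inputs/Holds), `Skeleton.prop22_eventually`
(Section4Prop22Eventually), `EllScales.Scales.ell_sub_one` (KnifeEdgeEllScales).
-/

noncomputable section

open Complex Real Set
open scoped ComplexConjugate

namespace Literature.NumberTheory.LFunctions.Zhang2022.KnifeEdgeEll.Vernier

open Literature.NumberTheory.LFunctions.Zhang2022 Skeleton

variable {D : ℕ} [NeZero D] (χ : DirichletCharacter ℂ D)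

/-- **A far-pair zero weight with free heights:** `𝔠*_{v,v′}(ρ,ψ) := −i·M(ρ+β₁)·M(ρ+iv)·M(ρ+iv′)/M′(ρ)` — Zhang's `𝔠*`
with the sub-gap shift `β₁` of (2.13) kept and the pair `(β₂, β₃)` replaced by `(iv, iv′)`. The card's vernier weight
`cstarVernier θ c'` is the instance `v = α̃(p)(J+m)`, `v′ = α̃(p)(J+1−m)` (`cstarVernier_eq_cstarPair`).
[cite: Zhang2022LandauSiegel, §2 p. 5, (2.13)–(2.14)] -/
def cstarPair (c' : ℝ) (D : ℕ) (x : Chr D) (ρ : ℂ) (v v' : ℝ) : ℂ :=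
  -I * Mfun x.ψ (ρ + beta1 c' D) * Mfun x.ψ (ρ + I * (v : ℂ)) * Mfun x.ψ (ρ + I * (v' : ℂ))
    / deriv (Mfun x.ψ) ρ

omit [NeZero D] in
/-- The vernier weight is the far-pair weight at the vernier heights. [cite: Zhang2022LandauSiegel, §2 (2.13)] -/
theorem cstarVernier_eq_cstarPair (θ c' : ℝ) (x : Chr D) (ρ : ℂ) :
    cstarVernier θ c' D x ρ
      = cstarPair c' D x ρ (alphaFence D x.p * ((vernierJAt θ D x.p : ℝ) + vernierMargin D))
          (alphaFence D x.p * ((vernierJAt θ D x.p : ℝ) + 1 - vernierMargin D)) := rfl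

/-- **The far bracket is clear at `(ψ, ρ)`:** no zero of `L(s,ψ)L(s,ψχ)` in `Ω` has ordinate in the CLOSED bracket
`[Im ρ + v, Im ρ + v′]` (the input Lemma 2.3's sign argument consumes for the pair `(iv, iv′)`; for the printed pair
it is supplied by Prop. 2.2 (iii)). [cite: Zhang2022LandauSiegel, §2 Lemma 2.3 (proof) pp. 11–12, Prop. 2.2] -/
def BracketClearAt (x : Chr D) (ρ : ℂ) (v v' : ℝ) : Prop :=
  ∀ s ∈ prodZeroSetOmega χ x, ¬ (ρ.im + v ≤ s.im ∧ s.im ≤ ρ.im + v')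

omit [NeZero D] in
/-- `𝔠*_{v,v′} = [M(ρ+β₁)/(iM′(ρ))]·[M(ρ+iv)M(ρ+iv′)]` (also when `M′(ρ) = 0`, both sides `0`).
[cite: Zhang2022LandauSiegel, §2 p. 5] -/
theorem cstarPair_eq_mul (c' : ℝ) (x : Chr D) (ρ : ℂ) (v v' : ℝ) :
    cstarPair c' D x ρ v v' = Mfun x.ψ (ρ + beta1 c' D) / (I * deriv (Mfun x.ψ) ρ) *
      (Mfun x.ψ (ρ + I * (v : ℂ)) * Mfun x.ψ (ρ + I * (v' : ℂ))) := by
  rw [cstarPair]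
  rcases eq_or_ne (deriv (Mfun x.ψ) ρ) 0 with h0 | h0
  · rw [h0]; simp
  · rw [div_mul_eq_mul_div, div_eq_div_iff h0 (mul_ne_zero I_ne_zero h0)]
    linear_combination (-(Mfun x.ψ (ρ + beta1 c' D) * Mfun x.ψ (ρ + I * (v : ℂ)) *
      Mfun x.ψ (ρ + I * (v' : ℂ)) * deriv (Mfun x.ψ) ρ)) * I_sq

/-- **The far factor is a positive real when the far bracket is clear** (the second half of the printed sign argument,
"`M(ρ+β₂)M(ρ+β₃) > 0` since `M(½+iu,ψ)` is real, continuous and non-vanishing on the range", transported to heights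
`0 < v ≤ v′ < 2` — no dependence on HOW FAR the pair sits): needs only Prop. 2.2 (i) at `ψ` and `D ≥ 3`.
[cite: Zhang2022LandauSiegel, §2 Lemma 2.3 (proof) pp. 11–12] -/
theorem farPair_pos_of_clear (hD : 3 ≤ D) (x : Chr D)
    (h_i : ∀ s ∈ prodZeroSetOmega χ x, s.re = 1 / 2) {ρ : ℂ} (hρ : ρ ∈ zeroSet D x) {v v' : ℝ}
    (hv : 0 < v) (hvv' : v ≤ v') (hv'2 : v' < 2) (hclear : BracketClearAt χ x ρ v v') :
    (Mfun x.ψ (ρ + I * (v : ℂ)) * Mfun x.ψ (ρ + I * (v' : ℂ))).im = 0 ∧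
      0 < (Mfun x.ψ (ρ + I * (v : ℂ)) * Mfun x.ψ (ρ + I * (v' : ℂ))).re := by
  have hρS : ρ ∈ prodZeroSetOmega χ x := mem_prodZeroSetOmega_of_mem_zeroSet χ hρ
  have hγ : 0 < ρ.im := im_pos_of_mem_zeroSet hD hρ
  have hre : ρ.re = 1 / 2 := h_i ρ hρS
  have hρeq : ρ = (1 : ℂ) / 2 + (ρ.im : ℂ) * I := Complex.ext (by simp [hre]) (by simp)
  have hsh : ∀ w : ℝ, ρ + I * (w : ℂ) = (1 : ℂ) / 2 + ((ρ.im + w : ℝ) : ℂ) * I := by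
    intro w; apply Complex.ext <;> simp [hre]
  -- the real function `m(u) = M(½+iu,ψ)` does not vanish on the clear bracket
  set m : ℝ → ℝ := fun u => (Mfun x.ψ ((1 : ℂ) / 2 + u * I)).re with hm_def
  have hmne : ∀ u ∈ Icc (ρ.im + v) (ρ.im + v'), m u ≠ 0 := by
    intro u hu hmu
    have hupos : 0 < u := by linarith [hu.1]
    have hL : x.ψ.LFunction ((1 : ℂ) / 2 + u * I) ≠ 0 := by
      intro hL0
      have hΩ : (1 : ℂ) / 2 + u * I ∈ Omega D := half_add_mem_Omega hρ (by linarith [hu.1]) (by linarith [hu.2])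
      have hs : (1 : ℂ) / 2 + (u : ℂ) * I ∈ prodZeroSetOmega χ x := ⟨hΩ, by rw [hL0, zero_mul]⟩
      exact hclear _ hs ⟨by simpa using hu.1, by simpa using hu.2⟩
    have hM := Mfun_ne_zero x (s := (1 : ℂ) / 2 + u * I) (by simpa using hupos) hL
    rw [Mfun_half_eq_ofReal x hupos] at hM
    simp only [hm_def] at hmu
    rw [hmu, Complex.ofReal_zero] at hM
    exact hM rfl
  have hsign : 0 < m (ρ.im + v) * m (ρ.im + v') :=
    mul_pos_of_continuousOn_of_ne_zero (by linarith) (continuousOn_Mfun_half_re x (by linarith)) hmne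
  have hM₂ : Mfun x.ψ (ρ + I * (v : ℂ)) = ((m (ρ.im + v) : ℝ) : ℂ) := by
    rw [hsh]; exact Mfun_half_eq_ofReal x (by linarith)
  have hM₃ : Mfun x.ψ (ρ + I * (v' : ℂ)) = ((m (ρ.im + v') : ℝ) : ℂ) := by
    rw [hsh]; exact Mfun_half_eq_ofReal x (by linarith)
  rw [hM₂, hM₃, ← Complex.ofReal_mul, Complex.ofReal_im, Complex.ofReal_re]
  exact ⟨rfl, hsign⟩

/-- **Lemma 2.3 transported, at one zero:** under Prop. 2.2 (i)–(iii) at `ψ` (and the smallness `5c′α𝓛 < 1`,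
`α ≤ 1/2` of the printed proof, `c′ ≥ 0`, `D ≥ 3`), for `ρ ∈ 𝔷(ψ)` and heights `0 < v ≤ v′ < 2` with the far bracket
`[Im ρ + v, Im ρ + v′]` clear of product zeros, the far-pair weight `𝔠*_{v,v′}(ρ,ψ)` is a POSITIVE real: the near
factor `M(ρ+β₁)/(iM′(ρ)) > 0` is the printed one (`Skeleton.M_signs_of_prop22_at`), the far factor is
`farPair_pos_of_clear`. [cite: Zhang2022LandauSiegel, §2 Lemma 2.3 (proof) pp. 11–12] -/
theorem cstarPair_pos_at (hD : 3 ≤ D) (hχ : χ.IsPrimitive) {c' : ℝ} (hc' : 0 ≤ c')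
    (hsmall : 5 * c' * alpha D * ell D < 1) (hαhalf : alpha D ≤ 1 / 2) (x : Chr D)
    (h_i : ∀ s ∈ prodZeroSetOmega χ x, s.re = 1 / 2)
    (h_ii : ∀ s ∈ prodZeroSetOmega χ x,
      deriv (fun w => x.ψ.LFunction w * (psiChi χ x).LFunction w) s ≠ 0)
    (h_iii : ∀ s ∈ prodZeroSetOmega χ x, ∀ s' ∈ prodZeroSetOmega χ x, s.im < s'.im →
      (∀ s'' ∈ prodZeroSetOmega χ x, ¬ (s.im < s''.im ∧ s''.im < s'.im)) →
        |s'.im - s.im - alpha D| < c' * alpha D ^ 2 * ell D)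
    {ρ : ℂ} (hρ : ρ ∈ zeroSet D x) {v v' : ℝ} (hv : 0 < v) (hvv' : v ≤ v') (hv'2 : v' < 2)
    (hclear : BracketClearAt χ x ρ v v') :
    (cstarPair c' D x ρ v v').im = 0 ∧ 0 < (cstarPair c' D x ρ v v').re := by
  obtain ⟨⟨hqi, hqr⟩, -⟩ := M_signs_of_prop22_at χ hD hχ hc' hsmall hαhalf x h_i h_ii h_iii hρ
  obtain ⟨hwi, hwr⟩ := farPair_pos_of_clear χ hD x h_i hρ hv hvv' hv'2 hclear
  rw [cstarPair_eq_mul]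
  generalize Mfun x.ψ (ρ + beta1 c' D) / (I * deriv (Mfun x.ψ) ρ) = q at hqi hqr ⊢
  generalize Mfun x.ψ (ρ + I * (v : ℂ)) * Mfun x.ψ (ρ + I * (v' : ℂ)) = w at hwi hwr ⊢
  rw [Complex.mul_im, Complex.mul_re, hqi, hwi, mul_zero, zero_mul, add_zero, mul_zero, sub_zero]
  exact ⟨rfl, mul_pos hqr hwr⟩

/-! ## The vernier heights are eventually admissible for the transported argument (`0 < v ≤ v′ < 2`) -/

/-- `L₀ ≤ log D` once `D ≥ ⌈exp L₀⌉₊`. [cite: Zhang2022LandauSiegel, §2 p. 4] -/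
private theorem le_log_of_ceil_exp_le' {L₀ : ℝ} {D : ℕ} (hD : ⌈Real.exp L₀⌉₊ ≤ D) : L₀ ≤ Real.log D := by
  have h : Real.exp L₀ ≤ D := le_trans (Nat.le_ceil _) (by exact_mod_cast hD)
  exact (Real.le_log_iff_exp_le (lt_of_lt_of_le (Real.exp_pos _) h)).mpr h

omit [NeZero D] in
/-- The true-fence unit unfolded: `L_Δ(p) = log(p·√D·𝓛⁵¹⁹)` at the printed scales. [cite: Zhang2022LandauSiegel, §2 (2.10)] -/
theorem pinned_LDelta (p : ℝ) :
    (EllScales.Scales.pinned D).LDelta p = Real.log (p * Real.sqrt D * Real.log D ^ 519) := rfl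

omit [NeZero D] in
/-- For a member `ψ (mod p)` and `D ≥ 3`: `L_Δ(p) ≥ 𝓛⁹` (`p > P = exp 𝓛⁹`, `√D·t₀ ≥ 1`), in particular `L_Δ(p) > 0`.
[cite: Zhang2022LandauSiegel, §2 (2.6), (2.10)] -/
theorem ell_pow_nine_le_LDelta (hD : 3 ≤ D) (x : Chr D) :
    Real.log D ^ 9 ≤ (EllScales.Scales.pinned D).LDelta x.p := by
  have hD' : (3 : ℝ) ≤ D := by exact_mod_cast hD
  have hlog : 1 ≤ Real.log (D : ℝ) := by
    have h3 : (1 : ℝ) < Real.log 3 := by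
      rw [Real.lt_log_iff_exp_lt (by norm_num)]
      exact Real.exp_one_lt_d9.trans (by norm_num)
    exact le_trans h3.le (Real.log_le_log (by norm_num) hD')
  have hDP : (D : ℝ) ≤ bigP D := by
    rw [bigP, ell]
    calc (D : ℝ) = Real.exp (Real.log D) := (Real.exp_log (by positivity)).symm
      _ ≤ Real.exp (Real.log D ^ 9) := Real.exp_le_exp.mpr (by
          calc Real.log D = Real.log D ^ 1 := (pow_one _).symm
            _ ≤ Real.log D ^ 9 := pow_le_pow_right₀ hlog (by norm_num))
  have hPp : bigP D < x.p := by
    have hm := x.mem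
    rw [primeWindow, Finset.mem_filter, Finset.mem_Ioo] at hm
    exact (Nat.floor_lt (le_trans (by positivity) hDP)).mp hm.1.1
  have hp0 : (0 : ℝ) < x.p := lt_of_le_of_lt (le_trans (by positivity) hDP) hPp
  have hsqrt : 1 ≤ Real.sqrt (D : ℝ) := Real.one_le_sqrt.mpr (by linarith)
  have ht0 : 1 ≤ Real.log (D : ℝ) ^ 519 := one_le_pow₀ hlog
  rw [pinned_LDelta]
  have hprod : (x.p : ℝ) ≤ x.p * Real.sqrt D * Real.log D ^ 519 := by
    calc (x.p : ℝ) = x.p * 1 * 1 := by ring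
      _ ≤ x.p * Real.sqrt D * Real.log D ^ 519 := by gcongr
  calc Real.log D ^ 9 = Real.log (bigP D) := by rw [bigP, ell, Real.log_exp]
    _ ≤ Real.log x.p := Real.log_le_log (by rw [bigP]; exact Real.exp_pos _) hPp.le
    _ ≤ _ := Real.log_le_log hp0 hprod

omit [NeZero D] in
/-- The true fence is positive: `α̃(p) > 0` for a member `ψ (mod p)`, `D ≥ 3`. [cite: Zhang2022LandauSiegel, §2 (2.10)] -/
theorem alphaFence_pos (hD : 3 ≤ D) (x : Chr D) : 0 < alphaFence D x.p := by
  have h := ell_pow_nine_le_LDelta hD x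
  have hlog : 0 < Real.log (D : ℝ) := Real.log_pos (by exact_mod_cast (by omega : 1 < D))
  exact div_pos Real.pi_pos (lt_of_lt_of_le (pow_pos hlog 9) h)

omit [NeZero D] in
/-- `α̃(p) ≤ π/𝓛⁹`. [cite: Zhang2022LandauSiegel, §2 (2.10)] -/
theorem alphaFence_le (hD : 3 ≤ D) (x : Chr D) : alphaFence D x.p ≤ π / Real.log D ^ 9 := by
  have h := ell_pow_nine_le_LDelta hD x
  have hlog : 0 < Real.log (D : ℝ) := Real.log_pos (by exact_mod_cast (by omega : 1 < D))
  exact div_le_div_of_nonneg_left Real.pi_pos.le (pow_pos hlog 9) h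

/-- **The vernier heights are eventually admissible:** for `θ ≥ 0` and `D ≥ D₀(θ)` (`𝓛 ≥ max(16, 2πθ + 4)`), at every
member `ψ (mod p)`: `0 < α̃(J+m) ≤ α̃(J+1−m) < 2` where `J = ⌊θ/(ℓ(p)−1)⌋`, `m = 𝓛^{−1/4}`, `α̃ = π/L_Δ(p)` — because
`α̃·J ≤ πθ/(½𝓛 − log 2π) ≤ 1`, `α̃ ≤ π/𝓛⁹` and `m ≤ ½`. [cite: Zhang2022LandauSiegel, §2 (2.6), (2.10), (2.13)] -/
theorem vernierHeights_eventually {θ : ℝ} (hθ : 0 ≤ θ) :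
    ForAllLarge fun D _ _ => ∀ x : Chr D,
      0 < alphaFence D x.p * ((vernierJAt θ D x.p : ℝ) + vernierMargin D) ∧
      alphaFence D x.p * ((vernierJAt θ D x.p : ℝ) + vernierMargin D)
        ≤ alphaFence D x.p * ((vernierJAt θ D x.p : ℝ) + 1 - vernierMargin D) ∧
      alphaFence D x.p * ((vernierJAt θ D x.p : ℝ) + 1 - vernierMargin D) < 2 := by
  refine ⟨max 3 ⌈Real.exp (max 16 (2 * π * θ + 4))⌉₊, fun D _ χ hD _ _ x => ?_⟩
  have hD3 : 3 ≤ D := le_trans (le_max_left _ _) hD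
  have hL := le_log_of_ceil_exp_le' (le_trans (le_max_right _ _) hD)
  have hL16 : 16 ≤ Real.log (D : ℝ) := le_trans (le_max_left _ _) hL
  have hLθ : 2 * π * θ + 4 ≤ Real.log (D : ℝ) := le_trans (le_max_right _ _) hL
  have hπ := Real.pi_pos
  have hπ4 : π < 4 := Real.pi_lt_four
  set L : ℝ := Real.log (D : ℝ) with hLdef
  -- the fence
  have hα := alphaFence_pos hD3 x
  have hαle := alphaFence_le hD3 x
  set a : ℝ := alphaFence D x.p with ha
  have hL9 : L ≤ L ^ 9 := le_self_pow₀ (by linarith) (by norm_num)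
  have hαsmall : a ≤ 1 / 2 := by
    calc a ≤ π / L ^ 9 := hαle
      _ ≤ π / 16 := div_le_div_of_nonneg_left hπ.le (by norm_num) (le_trans hL16 hL9)
      _ ≤ 1 / 2 := by linarith
  -- the margin
  set m : ℝ := vernierMargin D with hm
  have hm_pos : 0 < m := by
    rw [hm, vernierMargin, ell]; exact Real.rpow_pos_of_pos (by linarith) _
  have hm_half : m ≤ 1 / 2 := by
    rw [hm, vernierMargin, ell, Real.rpow_neg (by linarith)]
    have h2 : (2 : ℝ) ≤ Real.log D ^ (1 / 4 : ℝ) := by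
      have e : (2 : ℝ) = (16 : ℝ) ^ (1 / 4 : ℝ) := by
        rw [show (16 : ℝ) = 2 ^ (4 : ℝ) by norm_num, ← Real.rpow_mul (by norm_num)]; norm_num
      rw [e]; exact Real.rpow_le_rpow (by norm_num) hL16 (by norm_num)
    rw [inv_le_comm₀ (by positivity) (by norm_num)]
    linarith
  -- the gap count: `J ≤ θ·L_Δ/δ`, `δ = ½𝓛 − log 2π ≥ πθ + …`
  set LΔ : ℝ := (EllScales.Scales.pinned D).LDelta x.p with hLΔ
  have hLΔ9 : L ^ 9 ≤ LΔ := ell_pow_nine_le_LDelta hD3 x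
  have hLΔpos : 0 < LΔ := lt_of_lt_of_le (by positivity) hLΔ9
  have haLΔ : a * LΔ = π := by rw [ha, alphaFence, ← hLΔ]; field_simp
  set δ : ℝ := Real.log (Real.sqrt (D : ℝ)) - Real.log (2 * π) with hδ
  have hlog2π : Real.log (2 * π) < 2 := by
    rw [Real.log_lt_iff_lt_exp (by positivity)]
    have he := Real.exp_one_gt_d9
    have hπ3 : π < 3.15 := Real.pi_lt_d2
    have h2 : Real.exp 2 = Real.exp 1 * Real.exp 1 := by rw [← Real.exp_add]; norm_num
    have hee : (2.7182818283 : ℝ) * 2.7182818283 < Real.exp 1 * Real.exp 1 :=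
      mul_lt_mul'' he he (by norm_num) (by norm_num)
    rw [h2]
    linarith
  have hδeq : Real.log (Real.sqrt (D : ℝ)) = L / 2 := by
    rw [hLdef, Real.log_sqrt (by positivity)]
  have hδθ : π * θ < δ := by rw [hδ, hδeq]; nlinarith
  have hδpos : 0 < δ := lt_of_le_of_lt (by positivity) hδθ
  have hp0 : (0 : ℝ) < x.p := by exact_mod_cast x.prime.pos
  have hell1 : (EllScales.Scales.pinned D).ell x.p - 1 = δ / LΔ := by
    rw [hδ, hLΔ]
    have := EllScales.Scales.ell_sub_one (EllScales.Scales.pinned D) (p := (x.p : ℝ)) hp0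
      (by show (0 : ℝ) < Real.log D ^ 519; positivity) (by show (0 : ℝ) < ((D : ℕ) : ℝ); positivity)
      hLΔpos.ne'
    have hDD : (EllScales.Scales.pinned D).D = D := rfl
    rw [hDD] at this
    exact this
  have hJ : (vernierJAt θ D x.p : ℝ) ≤ θ * LΔ / δ := by
    rw [vernierJAt, vernierJ, hell1]
    have hq : 0 ≤ θ / (δ / LΔ) := div_nonneg hθ (div_nonneg hδpos.le hLΔpos.le)
    calc (⌊θ / (δ / LΔ)⌋₊ : ℝ) ≤ θ / (δ / LΔ) := Nat.floor_le hq
      _ = θ * LΔ / δ := by field_simp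
  set J : ℝ := (vernierJAt θ D x.p : ℝ) with hJdef
  have hJ0 : 0 ≤ J := Nat.cast_nonneg _
  have haJ : a * J ≤ 1 := by
    calc a * J ≤ a * (θ * LΔ / δ) := mul_le_mul_of_nonneg_left hJ hα.le
      _ = π * θ / δ := by rw [← haLΔ]; field_simp
      _ ≤ 1 := by rw [div_le_one hδpos]; exact hδθ.le
  refine ⟨by positivity, ?_, ?_⟩
  · exact mul_le_mul_of_nonneg_left (by linarith) hα.le
  · calc a * (J + 1 - m) ≤ a * (J + 1) := mul_le_mul_of_nonneg_left (by linarith) hα.le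
      _ = a * J + a := by ring
      _ < 2 := by linarith

/-! ## K4 from a clear far bracket (K2♭), eventually — and with Prop. 2.2 discharged -/

/-- **K2♭ — the far bracket is clear at EVERY coherent pair** (no exceptional set; (A)-guarded to match K4's shape):
under (A), eventually in `D`, for every coherent member `ψ` and every `ρ ∈ 𝔷(ψ)`, no zero of `L(s,ψ)L(s,ψχ)` in `Ω`
has ordinate in `[Im ρ + α̃(J+m), Im ρ + α̃(J+1−m)]`. The part of the card's K2 (coherence) that K4 consumes; the
second reader's `VernierBracketClear θ m` is the same conclusion off an `o(1)` exceptional set of pairs with a fixed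
margin. OPEN — asserted by no one. [cite: Zhang2022LandauSiegel, §2 Lemma 2.3, (2.13); §4 (4.10)–(4.11)] -/
def VernierBracketClearAll (θ : ℝ) : Prop :=
  ForAllLarge fun D _ χ => AssumptionA D χ → ∀ x : Chr D, CoherentMember χ x → ∀ ρ ∈ zeroSet D x,
    BracketClearAt χ x ρ (alphaFence D x.p * ((vernierJAt θ D x.p : ℝ) + vernierMargin D))
      (alphaFence D x.p * ((vernierJAt θ D x.p : ℝ) + 1 - vernierMargin D))

/-- **K4 IS LEMMA 2.3 TRANSPORTED (kernel): Prop. 2.2 (at constant `c′ ≥ 0`) and a clear far bracket at every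
coherent pair give `VernierPositivity θ c'`** — for `θ ≥ 0`; the distance `J ≍ θ𝓛⁸` of the pair plays no role in
the sign argument (second reader's (r1)), only the clear bracket does. [cite: Zhang2022LandauSiegel, §2 Lemma 2.3 (proof) pp. 11–12, Prop. 2.2] -/
theorem vernierPositivity_of_bracketClearAll {θ c' : ℝ} (hθ : 0 ≤ θ) (hc' : 0 ≤ c') (h22 : Prop22 c')
    (hB : VernierBracketClearAll θ) : VernierPositivity θ c' := by
  have hP := forAllLarge_of_prop22 h22 (S := fun D _ χ => ∀ x ∈ PsiOne χ,
      (∀ s ∈ prodZeroSetOmega χ x, s.re = 1 / 2) ∧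
      (∀ s ∈ prodZeroSetOmega χ x, deriv (fun w => x.ψ.LFunction w * (psiChi χ x).LFunction w) s ≠ 0) ∧
      (∀ s ∈ prodZeroSetOmega χ x, ∀ s' ∈ prodZeroSetOmega χ x, s.im < s'.im →
        (∀ s'' ∈ prodZeroSetOmega χ x, ¬ (s.im < s''.im ∧ s''.im < s'.im)) →
          |s'.im - s.im - alpha D| < c' * alpha D ^ 2 * ell D) ∧
      (3 ≤ D ∧ χ.IsPrimitive ∧ 5 * c' * alpha D * ell D < 1 ∧ alpha D ≤ 1 / 2))
    (fun D _ χ hD hp hsmall hαhalf h x hx => ⟨(h x hx).1, (h x hx).2.1, (h x hx).2.2, hD, hp, hsmall, hαhalf⟩)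
  refine ((hP.and (vernierHeights_eventually hθ)).and hB).mono ?_
  intro D _ χ _ _ h hA x hx ρ hρ
  obtain ⟨⟨hP', hH⟩, hB'⟩ := h
  obtain ⟨h_i, h_ii, h_iii, hD3, hp, hsmall, hαhalf⟩ := hP' x hx.1
  obtain ⟨hv, hvv', hv'2⟩ := hH x
  have hpos := cstarPair_pos_at χ hD3 hp hc' hsmall hαhalf x h_i h_ii h_iii hρ hv hvv' hv'2
    (hB' hA x hx ρ hρ)
  rw [cstarVernier_eq_cstarPair]
  exact ⟨hpos.1, hpos.2.le⟩

/-- **… with Proposition 2.2 DISCHARGED** (`Skeleton.prop22_eventually`: Prop. 2.2 holds for every sufficiently large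
`c′`, a tree theorem): for `θ ≥ 0` there is `c₀ ≥ 0` such that for all `c′ ≥ c₀`, K2♭ ⇒ K4. So in the vernier route K4
is not a crux: it is K2♭ plus kernel theorems. [cite: Zhang2022LandauSiegel, §2 Lemma 2.3, Prop. 2.2] -/
theorem vernierPositivity_of_bracketClearAll_closed {θ : ℝ} (hθ : 0 ≤ θ) (hB : VernierBracketClearAll θ) :
    ∃ c₀ : ℝ, 0 ≤ c₀ ∧ ∀ c' : ℝ, c₀ ≤ c' → VernierPositivity θ c' := by
  obtain ⟨c₀, h0, h⟩ := prop22_eventually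
  exact ⟨c₀, h0, fun c' hc' => vernierPositivity_of_bracketClearAll hθ (h0.trans hc') (h c' hc') hB⟩

/-! ## The route's glue with K4 discharged: dictionary + negative constant + clear bracket ⇒ Theorem 1 -/

/-- **Glue with K4 discharged:** for `θ ≥ 0`, `c′ ≥ 0` with Prop. 2.2 at `c′`: a vernier dictionary on the coherent
sub-family with NEGATIVE constant and a clear far bracket at every coherent pair give Theorem 1
(`theorem1_of_vernier_coherent` ∘ `vernierPositivity_of_bracketClearAll`; Prop. 2.2 (i) = `Skeleton.prop22i_holds`).
[cite: Zhang2022LandauSiegel, §1 Theorem 1; §2 p. 6, Lemma 2.3, Prop. 2.2] -/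
theorem theorem1_of_vernier_bracketClear {θ c' m : ℝ} {F : ValueTable} (hθ : 0 ≤ θ) (hc' : 0 ≤ c')
    (h22 : Prop22 c') (hdict : VernierDict θ c' coherentFam F m) (hm : m < 0) (hB : VernierBracketClearAll θ) :
    Theorem1 :=
  theorem1_of_vernier_coherent_closed hdict hm (vernierPositivity_of_bracketClearAll hθ hc' h22 hB)

/-- **… CLOSED in `c′`:** for `θ ≥ 0` there is `c₀ ≥ 0` such that for every `c′ ≥ c₀` the displayed inputs are exactly
the card's dictionary crux (K3 shape, slot `m` = D1's constant), the sign crux (`m < 0`, K1) and K2♭ — nothing of the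
manuscript's Part I is displayed. [cite: Zhang2022LandauSiegel, §1 Theorem 1; §2 Lemma 2.3, Prop. 2.2] -/
theorem theorem1_of_vernier_bracketClear_closed {θ : ℝ} (hθ : 0 ≤ θ) :
    ∃ c₀ : ℝ, 0 ≤ c₀ ∧ ∀ c' : ℝ, c₀ ≤ c' → ∀ {m : ℝ} {F : ValueTable},
      VernierDict θ c' coherentFam F m → m < 0 → VernierBracketClearAll θ → Theorem1 := by
  obtain ⟨c₀, h0, h⟩ := prop22_eventually
  exact ⟨c₀, h0, fun c' hc' _ _ hdict hm hB =>
    theorem1_of_vernier_bracketClear hθ (h0.trans hc') (h c' hc') hdict hm hB⟩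

end Literature.NumberTheory.LFunctions.Zhang2022.KnifeEdgeEll.Vernier

end
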